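import Mathlib
import Summits.HodgeConjecture.FermatCycles.HodgeFermatCoincFullK

/-!
# ALL CM-type coincidences at 15, 21, 39 — part 3: soundness, `fullAt_15/21/39`, the solitary types (`HodgeFermat/CoincFull.lean`; HF-G27e)

Tree copy (part 3 of 3) of the module `HodgeFermat/CoincFull.lean` of the sibling cell's standalone package
`run/shared/lean/pub/pub-hodgefermat/lean/HodgeFermat/` (414 lines, sha256 `5c1bda8e4e203d7d…`), source lines 150–414 (§3 soundness `fullAt_of_check`, `fullAt_15/21/39`, §4 the listed classes are real, §5 the solitary types `solo_*`).
Filed by cell `pub-hfermat`, seat prover-1 gen-3, on the COORDINATOR KEEPER RULING of 2026-08-25 (gem sweep H1: take the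
off-gate kernel theorem `thmFstar` through the gate) — here THEOREM F* of `tables/DPRIME-THEOREM.md` §9 IN FULL, i.e.
PROPOSITION D′(3N) and the descent (`HodgeFermat/PropDPrimeNFinal.lean`, GATE HF-G34), the last off-gate form of THEOREM F*
(its first two forms, `DecodingFinal.thmFstar` = F* at the prime levels and `ThmFstarNFinal.thmFstar` = F*(3N), landed on
2026-08-25 as `HodgeFermatThmFstar.lean` / `HodgeFermatThmFstarN.lean`, seats prover-1 gen-0 / gen-2); this file is one link of
the import closure of `PropDPrimeNFinal.propDprime` (the sibling's KR-free chain: THEOREM L, COROLLARY M, THEOREM D6,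
THEOREM U⁺, THEOREM KR6, THEOREM Z3U) on top of those landed chains.  The source module is the sibling's hub-checked module of
record (pub-hodgefermat `CERT.md` l.924, GATE HF-G27e; cell record `check/CoincFull_standalone.lean` sha256 `a5accc41040c0f38…`); its declarations are copied VERBATIM.
Deviations from the source module, exhaustively: the `import` lines (tree modules `Summits.HodgeConjecture.FermatCycles.
HodgeFermat*` instead of `HodgeFermat.*`); this module docstring; the `set_option`/namespace/`open` preamble (source l.31–35) is repeated at the top because the module is split; DEDUP (pre-empting the gate's `dedup.landed`): the source's `lemma not_dvd_mul` (l.238–240) restates the landed `HodgeFermat.KRFree.Decoding.unit_mul_not_dvd` (`HodgeFermatDecodingC.lean`) VERBATIM up to the names of bound variables and is DELETED, re-bound by the added line `open HodgeFermat.KRFree.Decoding renaming unit_mul_not_dvd → not_dvd_mul`; one-line docstrings added (gate lint) to `mem_nzList`, `mem_nzList_mod`, `inClass_of_B`, `inClass2_of_B`, `perm3_symm`, `perm3_trans`, `perm3_mem`, `perm3_sum`, `sameType_symm`, `classes15_sameType`, `classes21_sameType`, `classes39_sameType`, `solo_15₅`, `solo_15₁₀`, `solo_21₇`, `solo_21₁₄`,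 `solo_39₁₃`, `solo_39₂₆`. The module docstring is quoted in full in part 1.
Every other line — in particular every declaration's statement and proof — is byte-identical to the source.
HONEST FRAMING: explicit algebraic cycles for specific Hodge classes on Fermat/Delsarte varieties; residual open instances
listed; no claim on general Hodge.  (This file is arithmetic of CM types / finite combinatorics / analytic number theory
of the sibling's KR-free programme; it claims nothing about cycles.)
-/

set_option autoImplicit false

namespace HodgeFermat.KRFree.CoincFull

open HodgeFermat.KRFree.LemmaN HodgeFermat.KRFree.TheoremUEq HodgeFermat.KRFree.CoincEnum

open HodgeFermat.KRFree.Decoding renaming unit_mul_not_dvd → not_dvd_mul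

/-! ## Soundness -/

/-- `(A, B, C)` is, up to order, a member of `cl` -/
def InClass (cl : List Tri) (A B C : ℕ) : Prop := ∃ T ∈ cl, Perm3 A B C T.1 T.2.1 T.2.2

/-- the complete-list statement at level `N`: two zero-sum triples of NON-ZERO residues with the same CM type are
permutations of each other or lie, up to order, in one listed class -/
def FullAt (N : ℕ) (classes : List (List Tri)) : Prop :=
  ∀ a b c a' b' c' : ℕ,
    ¬ N ∣ a → ¬ N ∣ b → ¬ N ∣ c → ¬ N ∣ a' → ¬ N ∣ b' → ¬ N ∣ c' →
    N ∣ a + b + c → N ∣ a' + b' + c' →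
    SameType N (a, b, c) (a', b', c') →
    Perm3 (a % N) (b % N) (c % N) (a' % N) (b' % N) (c' % N) ∨
      ∃ cl ∈ classes, InClass cl (a % N) (b % N) (c % N) ∧ InClass cl (a' % N) (b' % N) (c' % N)

/-- membership in `nzList N`: `x < N` and `x ≠ 0` -/
lemma mem_nzList {N x : ℕ} : x ∈ nzList N ↔ x < N ∧ x ≠ 0 := by
  simp [nzList]

/-- the residue of a non-multiple of `N` lies in `nzList N` -/
lemma mem_nzList_mod {N x : ℕ} (hN : 0 < N) (hx : ¬ N ∣ x) : x % N ∈ nzList N :=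
  mem_nzList.mpr ⟨Nat.mod_lt x hN, fun h => hx (Nat.dvd_of_mod_eq_zero h)⟩

/-- soundness of the Boolean class-membership test `inClassB` -/
lemma inClass_of_B {cl : List Tri} {A B C : ℕ} (h : inClassB cl A B C = true) : InClass cl A B C := by
  obtain ⟨T, hT, hp⟩ := List.any_eq_true.mp h
  exact ⟨T, hT, perm3B_iff.mp hp⟩

/-- soundness of the Boolean test `inClass2B`: both triples lie in one listed class -/
lemma inClass2_of_B {classes : List (List Tri)} {A B C A' B' C' : ℕ} (h : inClass2B classes A B C A' B' C' = true) :
    ∃ cl ∈ classes, InClass cl A B C ∧ InClass cl A' B' C' := by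
  obtain ⟨cl, hcl, h2⟩ := List.any_eq_true.mp h
  rw [Bool.and_eq_true] at h2
  exact ⟨cl, hcl, inClass_of_B h2.1, inClass_of_B h2.2⟩

/-! ### `Perm3` is "equal as multisets": symmetry, transitivity, a sorted representative -/

/-- `Perm3` is symmetric -/
lemma perm3_symm {A B C x y z : ℕ} (h : Perm3 A B C x y z) : Perm3 x y z A B C := by
  rcases h with ⟨rfl, rfl, rfl⟩ | ⟨rfl, rfl, rfl⟩ | ⟨rfl, rfl, rfl⟩ | ⟨rfl, rfl, rfl⟩ | ⟨rfl, rfl, rfl⟩ | ⟨rfl, rfl, rfl⟩ <;>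
    simp [Perm3]

/-- `Perm3` is transitive -/
lemma perm3_trans {A B C x y z u v w : ℕ} (h1 : Perm3 A B C x y z) (h2 : Perm3 x y z u v w) : Perm3 A B C u v w := by
  rcases h1 with ⟨rfl, rfl, rfl⟩ | ⟨rfl, rfl, rfl⟩ | ⟨rfl, rfl, rfl⟩ | ⟨rfl, rfl, rfl⟩ | ⟨rfl, rfl, rfl⟩ | ⟨rfl, rfl, rfl⟩ <;>
  rcases h2 with ⟨rfl, rfl, rfl⟩ | ⟨rfl, rfl, rfl⟩ | ⟨rfl, rfl, rfl⟩ | ⟨rfl, rfl, rfl⟩ | ⟨rfl, rfl, rfl⟩ | ⟨rfl, rfl, rfl⟩ <;>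
    simp [Perm3]

/-- the entries of a `Perm3`-related triple are entries of the original -/
lemma perm3_mem {A B C x y z : ℕ} (h : Perm3 A B C x y z) :
    (x = A ∨ x = B ∨ x = C) ∧ (y = A ∨ y = B ∨ y = C) ∧ (z = A ∨ z = B ∨ z = C) := by
  rcases h with ⟨rfl, rfl, rfl⟩ | ⟨rfl, rfl, rfl⟩ | ⟨rfl, rfl, rfl⟩ | ⟨rfl, rfl, rfl⟩ | ⟨rfl, rfl, rfl⟩ | ⟨rfl, rfl, rfl⟩ <;>
    simp

/-- a sum of a function over the entries is `Perm3`-invariant -/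
lemma perm3_sum {A B C x y z : ℕ} (h : Perm3 A B C x y z) (f : ℕ → ℕ) : f x + f y + f z = f A + f B + f C := by
  rcases h with ⟨rfl, rfl, rfl⟩ | ⟨rfl, rfl, rfl⟩ | ⟨rfl, rfl, rfl⟩ | ⟨rfl, rfl, rfl⟩ | ⟨rfl, rfl, rfl⟩ | ⟨rfl, rfl, rfl⟩ <;>
    omega

/-- every triple has a sorted permutation -/
lemma sorted_perm (A B C : ℕ) : ∃ x y z : ℕ, x ≤ y ∧ y ≤ z ∧ Perm3 A B C x y z := by
  unfold Perm3
  by_cases h1 : A ≤ B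
  · by_cases h2 : B ≤ C
    · exact ⟨A, B, C, h1, h2, Or.inl ⟨rfl, rfl, rfl⟩⟩
    · by_cases h3 : A ≤ C
      · exact ⟨A, C, B, h3, by omega, Or.inr (Or.inl ⟨rfl, rfl, rfl⟩)⟩
      · exact ⟨C, A, B, by omega, h1, Or.inr (Or.inr (Or.inr (Or.inl ⟨rfl, rfl, rfl⟩)))⟩
  · by_cases h2 : A ≤ C
    · exact ⟨B, A, C, by omega, h2, Or.inr (Or.inr (Or.inl ⟨rfl, rfl, rfl⟩))⟩
    · by_cases h3 : B ≤ C
      · exact ⟨B, C, A, h3, by omega, Or.inr (Or.inr (Or.inr (Or.inr (Or.inl ⟨rfl, rfl, rfl⟩))))⟩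
      · exact ⟨C, B, A, by omega, by omega, Or.inr (Or.inr (Or.inr (Or.inr (Or.inr ⟨rfl, rfl, rfl⟩))))⟩

/-! ### `H_T` is symmetric in the entries of a zero-sum triple of non-zero residues -/

/-- for a zero-sum triple with `ta, tb, tc ≢ 0`: `t ∈ H_T ⟺ ⟨ta⟩ + ⟨tb⟩ + ⟨tc⟩ = N` (the sum is `N` or `2N`) -/
lemma inH_iff_sum {N a b c t : ℕ} (hN : 0 < N) (h : N ∣ a + b + c) (ha : ¬ N ∣ t * a) (hb : ¬ N ∣ t * b)
    (hc : ¬ N ∣ t * c) : InH N (a, b, c) t ↔ t * a % N + t * b % N + t * c % N = N := by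
  have hα : 0 < t * a % N := Nat.pos_of_ne_zero fun e => ha (Nat.dvd_of_mod_eq_zero e)
  have hβ : 0 < t * b % N := Nat.pos_of_ne_zero fun e => hb (Nat.dvd_of_mod_eq_zero e)
  have hγ : 0 < t * c % N := Nat.pos_of_ne_zero fun e => hc (Nat.dvd_of_mod_eq_zero e)
  have lα := Nat.mod_lt (t * a) hN
  have lβ := Nat.mod_lt (t * b) hN
  have lγ := Nat.mod_lt (t * c) hN
  have H : N ∣ t * a + t * b + t * c := by
    have h' := Dvd.dvd.mul_left h t
    rwa [Nat.mul_add, Nat.mul_add] at h'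
  have hdiv : N ∣ t * a % N + t * b % N + t * c % N :=
    (Nat.modEq_zero_iff_dvd).1
      ((((Nat.mod_modEq (t * a) N).add (Nat.mod_modEq (t * b) N)).add (Nat.mod_modEq (t * c) N)).trans
        ((Nat.modEq_zero_iff_dvd).2 H))
  obtain ⟨k, hk⟩ := hdiv
  have hk3 : k < 3 := Nat.lt_of_mul_lt_mul_left (a := N) (by rw [← hk]; omega)
  show t * a % N + t * b % N < N ↔ _
  interval_cases k <;> omega

/-- `H` of a permuted triple -/
lemma inH_perm {N A B C x y z t : ℕ} (hN : 0 < N) (hp : Perm3 A B C x y z) (hs : N ∣ A + B + C)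
    (hA : ¬ N ∣ t * A) (hB : ¬ N ∣ t * B) (hC : ¬ N ∣ t * C) : (InH N (A, B, C) t ↔ InH N (x, y, z) t) := by
  obtain ⟨hx, hy, hz⟩ := perm3_mem hp
  have e1 := perm3_sum hp id
  simp only [id] at e1
  have e2 := perm3_sum hp (fun v => t * v % N)
  have nd : ∀ {v : ℕ}, (v = A ∨ v = B ∨ v = C) → ¬ N ∣ t * v := by
    rintro v (rfl | rfl | rfl) <;> assumption
  rw [inH_iff_sum hN hs hA hB hC, inH_iff_sum hN (by rw [e1]; exact hs) (nd hx) (nd hy) (nd hz), e2]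

/-- `SameType` along a permutation of the first triple -/
lemma sameType_perm {N A B C x y z : ℕ} {T' : Tri} (hN : 0 < N) (hp : Perm3 A B C x y z) (hs : N ∣ A + B + C)
    (hA : ¬ N ∣ A) (hB : ¬ N ∣ B) (hC : ¬ N ∣ C) (h : SameType N (A, B, C) T') : SameType N (x, y, z) T' :=
  fun t ht => (inH_perm hN hp hs (not_dvd_mul ht hA) (not_dvd_mul ht hB) (not_dvd_mul ht hC)).symm.trans (h t ht)

/-- `SameType` is symmetric (triples as `Tri`) -/
lemma sameType_symm {N : ℕ} {T T' : Tri} (h : SameType N T T') : SameType N T' T := fun t ht => (h t ht).symm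

/-- passing to residues does not change `H` -/
lemma inH_modEntries (N a b c k t : ℕ) : InH N (a % N, b % N, k) t ↔ InH N (a, b, c) t := by
  simp only [InH, Nat.mul_mod_mod]

/-- the sorted residue representative of a zero-sum triple with non-zero residues -/
lemma sorted_rep {N a b c : ℕ} (hN : 0 < N) (ha : ¬ N ∣ a) (hb : ¬ N ∣ b) (hc : ¬ N ∣ c) (hs : N ∣ a + b + c) :
    ∃ x y z : ℕ, Perm3 (a % N) (b % N) (c % N) x y z ∧ x ∈ nzList N ∧ y ∈ nzList N ∧ sortedB N x y = true ∧
      third N x y = z ∧ N ∣ x + y + z ∧ ¬ N ∣ x ∧ ¬ N ∣ y ∧ ¬ N ∣ z ∧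
      (∀ T' : Tri, SameType N (a, b, c) T' → SameType N (x, y, z) T') := by
  obtain ⟨x, y, z, hxy, hyz, hp⟩ := sorted_perm (a % N) (b % N) (c % N)
  obtain ⟨hx, hy, hz⟩ := perm3_mem hp
  have bA := Nat.mod_lt a hN
  have bB := Nat.mod_lt b hN
  have bC := Nat.mod_lt c hN
  have pA : 0 < a % N := Nat.pos_of_ne_zero fun e => ha (Nat.dvd_of_mod_eq_zero e)
  have pB : 0 < b % N := Nat.pos_of_ne_zero fun e => hb (Nat.dvd_of_mod_eq_zero e)
  have pC : 0 < c % N := Nat.pos_of_ne_zero fun e => hc (Nat.dvd_of_mod_eq_zero e)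
  have bx : 0 < x ∧ x < N := by rcases hx with rfl | rfl | rfl <;> omega
  have by' : 0 < y ∧ y < N := by rcases hy with rfl | rfl | rfl <;> omega
  have bz : 0 < z ∧ z < N := by rcases hz with rfl | rfl | rfl <;> omega
  have hsR : N ∣ a % N + b % N + c % N :=
    (Nat.modEq_zero_iff_dvd).1
      ((((Nat.mod_modEq a N).add (Nat.mod_modEq b N)).add (Nat.mod_modEq c N)).trans ((Nat.modEq_zero_iff_dvd).2 hs))
  have e1 := perm3_sum hp id
  simp only [id] at e1
  have hsx : N ∣ x + y + z := by rw [e1]; exact hsR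
  have ndx : ¬ N ∣ x := fun h => absurd (Nat.le_of_dvd bx.1 h) (by omega)
  have ndy : ¬ N ∣ y := fun h => absurd (Nat.le_of_dvd by'.1 h) (by omega)
  have ndz : ¬ N ∣ z := fun h => absurd (Nat.le_of_dvd bz.1 h) (by omega)
  have h3 : third N x y = z := by
    have h := third_mod (c := z) hN hsx
    rwa [Nat.mod_eq_of_lt bx.2, Nat.mod_eq_of_lt by'.2, Nat.mod_eq_of_lt bz.2] at h
  have ndA : ¬ N ∣ a % N := fun h => absurd (Nat.le_of_dvd pA h) (by omega)
  have ndB : ¬ N ∣ b % N := fun h => absurd (Nat.le_of_dvd pB h) (by omega)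
  have ndC : ¬ N ∣ c % N := fun h => absurd (Nat.le_of_dvd pC h) (by omega)
  refine ⟨x, y, z, hp, mem_nzList.mpr ⟨bx.2, by omega⟩, mem_nzList.mpr ⟨by'.2, by omega⟩, ?_, h3, hsx, ndx, ndy, ndz, ?_⟩
  · simp only [sortedB, h3, Bool.and_eq_true, decide_eq_true_eq]
    exact ⟨⟨hxy, hyz⟩, by simpa using (show z ≠ 0 by omega)⟩
  · intro T' hT
    have hT' : SameType N (a % N, b % N, c % N) T' := fun t ht => (inH_modEntries N a b c (c % N) t).trans (hT t ht)
    exact sameType_perm hN hp hsR ndA ndB ndC hT'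

/-- the Boolean type test from `SameType`, for triples of residues `< N` -/
lemma sameTypeB_of_sameType {N x y z x' y' z' : ℕ} (h : SameType N (x, y, z) (x', y', z')) :
    sameTypeB N x y x' y' = true := by
  refine List.all_eq_true.mpr fun t ht => beq_iff_eq.mpr (Bool.eq_iff_iff.mpr ?_)
  have e : ∀ p q r : ℕ, (inHB N p q t = true ↔ InH N (p, q, r) t) := fun p q r => by
    simp only [inHB, InH, decide_eq_true_eq]
  rw [e x y z, e x' y' z']
  exact h t (mem_unitList.mp ht).2

/-- **Soundness of the checker.** -/
theorem fullAt_of_check {N : ℕ} (hN : 0 < N) {classes : List (List Tri)} (hq : fullCheck N classes = true) :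
    FullAt N classes := by
  intro a b c a' b' c' ha hb hc ha' hb' hc' hs hs' hT
  obtain ⟨x, y, z, hp, hxm, hym, hsrt, h3, -, -, -, -, htr⟩ := sorted_rep hN ha hb hc hs
  obtain ⟨x', y', z', hp', hxm', hym', hsrt', h3', hsx', ndx', ndy', ndz', htr'⟩ := sorted_rep hN ha' hb' hc' hs'
  -- same type of the sorted representatives
  have hTT : SameType N (x, y, z) (x', y', z') :=
    sameType_symm (htr' _ (sameType_symm (htr _ hT)))
  -- extract the step of the checker
  have h1 := List.all_eq_true.mp (List.all_eq_true.mp hq x hxm) y hym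
  rw [hsrt, Bool.not_true, Bool.false_or] at h1
  have h2 := List.all_eq_true.mp (List.all_eq_true.mp h1 x' hxm') y' hym'
  rw [hsrt', Bool.not_true, Bool.false_or] at h2
  simp only [fullStep, h3, h3', sameTypeB_of_sameType hTT, Bool.not_true, Bool.false_or, Bool.or_eq_true] at h2
  rcases h2 with h | h
  · exact Or.inl (perm3_trans hp (perm3_trans (perm3B_iff.mp h) (perm3_symm hp')))
  · obtain ⟨cl, hcl, ⟨T, hTm, hTp⟩, ⟨T', hTm', hTp'⟩⟩ := inClass2_of_B h
    exact Or.inr ⟨cl, hcl, ⟨T, hTm, perm3_trans hp hTp⟩, ⟨T', hTm', perm3_trans hp' hTp'⟩⟩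

/-- **§4.2 at level 15**: the complete list of CM-type coincidences. -/
theorem fullAt_15 : FullAt 15 classes15 := fullAt_of_check (by norm_num) fullCheck_15

/-- **§4.2 at level 21**. -/
theorem fullAt_21 : FullAt 21 classes21 := fullAt_of_check (by norm_num) fullCheck_21

/-- **§4.2 at level 39**. -/
theorem fullAt_39 : FullAt 39 classes39 := fullAt_of_check (by norm_num) fullCheck_39

/-! ## The converse: listed classes are genuine -/

/-- the Boolean type test decides `SameType` for triples of residues -/
lemma sameType_of_B {N a b c a' b' c' : ℕ} (hN : 0 < N) (h : sameTypeB N a b a' b' = true) :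
    SameType N (a, b, c) (a', b', c') := by
  refine sameType_of_fin hN fun t ht htc => ?_
  have h1 := List.all_eq_true.mp h t (mem_unitList.mpr ⟨ht, htc⟩)
  have h2 : inHB N a b t = inHB N a' b' t := eq_of_beq (by simpa using h1)
  have e : ∀ x y z : ℕ, (inHB N x y t = true ↔ InH N (x, y, z) t) := fun x y z => by
    simp only [inHB, InH, decide_eq_true_eq]
  rw [← e a b c, ← e a' b' c', h2]

/-- any two members of a listed class have zero sum, non-zero entries and the same CM type -/
theorem sameType_of_classesOK {N : ℕ} (hN : 0 < N) {classes : List (List Tri)} (h : classesOK N classes = true)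
    {cl : List Tri} (hcl : cl ∈ classes) {T T' : Tri} (hT : T ∈ cl) (hT' : T' ∈ cl) :
    N ∣ T.1 + T.2.1 + T.2.2 ∧ ¬ N ∣ T.1 ∧ ¬ N ∣ T.2.1 ∧ ¬ N ∣ T.2.2 ∧ SameType N T T' := by
  have h1 := List.all_eq_true.mp (List.all_eq_true.mp h cl hcl) T hT
  simp only [Bool.and_eq_true, decide_eq_true_eq, beq_iff_eq] at h1
  obtain ⟨⟨⟨⟨⟨⟨⟨h0a, haN⟩, h0b⟩, hbN⟩, h0c⟩, hcN⟩, hsum⟩, hall⟩ := h1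
  have h2 := List.all_eq_true.mp hall T' hT'
  refine ⟨Nat.dvd_of_mod_eq_zero hsum, ?_, ?_, ?_, ?_⟩
  · exact fun hd => absurd (Nat.le_of_dvd h0a hd) (by omega)
  · exact fun hd => absurd (Nat.le_of_dvd h0b hd) (by omega)
  · exact fun hd => absurd (Nat.le_of_dvd h0c hd) (by omega)
  · obtain ⟨x, y, z⟩ := T
    obtain ⟨x', y', z'⟩ := T'
    exact sameType_of_B hN h2

/-- two members of one class of `classes15` have the same CM type at 15 -/
theorem classes15_sameType {cl : List Tri} (hcl : cl ∈ classes15) {T T' : Tri} (hT : T ∈ cl) (hT' : T' ∈ cl) :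
    SameType 15 T T' := (sameType_of_classesOK (by norm_num) classesOK_15 hcl hT hT').2.2.2.2

/-- two members of one class of `classes21` have the same CM type at 21 -/
theorem classes21_sameType {cl : List Tri} (hcl : cl ∈ classes21) {T T' : Tri} (hT : T ∈ cl) (hT' : T' ∈ cl) :
    SameType 21 T T' := (sameType_of_classesOK (by norm_num) classesOK_21 hcl hT hT').2.2.2.2

/-- two members of one class of `classes39` have the same CM type at 39 -/
theorem classes39_sameType {cl : List Tri} (hcl : cl ∈ classes39) {T T' : Tri} (hT : T ∈ cl) (hT' : T' ∈ cl) :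
    SameType 39 T T' := (sameType_of_classesOK (by norm_num) classesOK_39 hcl hT hT').2.2.2.2

/-! ## Solitary types: `±(N/3)(1,1,1)` (SEMI §3b, Case 3) -/

/-- soundness of `soloCheck` -/
theorem solo_of_check {N x : ℕ} (hN : 0 < N) (hq : soloCheck N x = true) (a b c : ℕ)
    (ha : ¬ N ∣ a) (hb : ¬ N ∣ b) (hc : ¬ N ∣ c) (hs : N ∣ a + b + c) (hT : SameType N (a, b, c) (x, x, x)) :
    a % N = x ∧ b % N = x ∧ c % N = x := by
  have step := List.all_eq_true.mp (List.all_eq_true.mp hq _ (mem_nzList_mod hN ha)) _ (mem_nzList_mod hN hb)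
  have h3 : third N (a % N) (b % N) = c % N := third_mod hN hs
  have hc0 : ((c % N) == 0) = false := beq_eq_false_iff_ne.mpr fun h => hc (Nat.dvd_of_mod_eq_zero h)
  have hTB : sameTypeB N (a % N) (b % N) x x = true := by
    refine List.all_eq_true.mpr fun t ht => beq_iff_eq.mpr (Bool.eq_iff_iff.mpr ?_)
    have e : inHB N x x t = true ↔ InH N (x, x, x) t := by simp only [inHB, InH, decide_eq_true_eq]
    rw [inHB_iff c, e]
    exact hT t (mem_unitList.mp ht).2
  simp only [h3, hc0, hTB, Bool.not_true, Bool.false_or] at step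
  rcases perm3B_iff.mp step with ⟨h1, h2, h3⟩ | ⟨h1, h2, h3⟩ | ⟨h1, h2, h3⟩ | ⟨h1, h2, h3⟩ | ⟨h1, h2, h3⟩ | ⟨h1, h2, h3⟩ <;>
    exact ⟨h1, h2, h3⟩

/-- the CM type of `(5, 5, 5)` at level 15 is solitary -/
theorem solo_15₅ (a b c : ℕ) (ha : ¬ 15 ∣ a) (hb : ¬ 15 ∣ b) (hc : ¬ 15 ∣ c) (hs : 15 ∣ a + b + c)
    (hT : SameType 15 (a, b, c) (5, 5, 5)) : a % 15 = 5 ∧ b % 15 = 5 ∧ c % 15 = 5 :=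
  solo_of_check (by norm_num) soloCheck_15₅ a b c ha hb hc hs hT
/-- the CM type of `(10, 10, 10)` at level 15 is solitary -/
theorem solo_15₁₀ (a b c : ℕ) (ha : ¬ 15 ∣ a) (hb : ¬ 15 ∣ b) (hc : ¬ 15 ∣ c) (hs : 15 ∣ a + b + c)
    (hT : SameType 15 (a, b, c) (10, 10, 10)) : a % 15 = 10 ∧ b % 15 = 10 ∧ c % 15 = 10 :=
  solo_of_check (by norm_num) soloCheck_15₁₀ a b c ha hb hc hs hT
/-- the CM type of `(7, 7, 7)` at level 21 is solitary -/
theorem solo_21₇ (a b c : ℕ) (ha : ¬ 21 ∣ a) (hb : ¬ 21 ∣ b) (hc : ¬ 21 ∣ c) (hs : 21 ∣ a + b + c)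
    (hT : SameType 21 (a, b, c) (7, 7, 7)) : a % 21 = 7 ∧ b % 21 = 7 ∧ c % 21 = 7 :=
  solo_of_check (by norm_num) soloCheck_21₇ a b c ha hb hc hs hT
/-- the CM type of `(14, 14, 14)` at level 21 is solitary -/
theorem solo_21₁₄ (a b c : ℕ) (ha : ¬ 21 ∣ a) (hb : ¬ 21 ∣ b) (hc : ¬ 21 ∣ c) (hs : 21 ∣ a + b + c)
    (hT : SameType 21 (a, b, c) (14, 14, 14)) : a % 21 = 14 ∧ b % 21 = 14 ∧ c % 21 = 14 :=
  solo_of_check (by norm_num) soloCheck_21₁₄ a b c ha hb hc hs hT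
/-- the CM type of `(13, 13, 13)` at level 39 is solitary -/
theorem solo_39₁₃ (a b c : ℕ) (ha : ¬ 39 ∣ a) (hb : ¬ 39 ∣ b) (hc : ¬ 39 ∣ c) (hs : 39 ∣ a + b + c)
    (hT : SameType 39 (a, b, c) (13, 13, 13)) : a % 39 = 13 ∧ b % 39 = 13 ∧ c % 39 = 13 :=
  solo_of_check (by norm_num) soloCheck_39₁₃ a b c ha hb hc hs hT
/-- the CM type of `(26, 26, 26)` at level 39 is solitary -/
theorem solo_39₂₆ (a b c : ℕ) (ha : ¬ 39 ∣ a) (hb : ¬ 39 ∣ b) (hc : ¬ 39 ∣ c) (hs : 39 ∣ a + b + c)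
    (hT : SameType 39 (a, b, c) (26, 26, 26)) : a % 39 = 26 ∧ b % 39 = 26 ∧ c % 39 = 26 :=
  solo_of_check (by norm_num) soloCheck_39₂₆ a b c ha hb hc hs hT

end HodgeFermat.KRFree.CoincFull
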